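import Summits.ABC.ABC.Theses.IsogenyGlueCongruence
import Literature.NumberTheory.EllipticCurves.RationalIsogenyDegreesProofs
import HarnessLib

/-!
# CM isotypic core (stub `stub_CMIsotypicCoreOf`, line `Sketch`) — helpers 1/2: the CM torsion
# fact makes the mod-`ℓ` Galois image non-abelian

Helper file (1/2) for stub `stub_CMIsotypicCoreOf` (the CM isotypic core (K\*)) of line `Sketch`
(isotypic–Minkowski reduction) of crux U
`Summit.ABC.ABC.Theses.IsogenyGlueCongruence.EllipticGluingPrimeBound` (stmt-ABC-13919); the stub
itself is proved in `…EllipticGluingPrimeBoundStubCMIsotypicCoreOf`, the second helper file is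
`…StubCMIsotypicCoreOfAux2`.

Throughout, "the CM torsion fact" is the HYPOTHESIS `hF2` of the stub (registered neighbour
`stub_cmTorsionCartanImage`, the main theorem of complex multiplication read on `W[ℓ]`, Lang 1987
Ch. 10 §4 Thm. 8): for `W/ℚ` with CM and a prime `ℓ > L₀`, an endomorphism `φ = √D` of `W[ℓ]`
(`φ² = D`, `ℓ ∤ D`, not a scalar), a quadratic character `χ` of `Γ_ℚ` with
`φ(σP) = χ(σ)·σφ(P)`, and a large Cartan image: every unit `a + b√D` of `O/ℓ` has its `12`-th power
realised on `W[ℓ]` by some `σ ∈ ker χ`. Nothing is assumed here: `hF2` is an explicit hypothesis of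
every theorem that uses it.

Contents (pure algebra on `W[ℓ]`; namespace `…IsotypicMinkowski.CMIsotypicCore` for the lemmas):
* `exists_sq_ne_and_eval_ne_zero` — for a prime `ℓ > 13` and `d ∈ 𝔽_ℓ` some `x` has `x² ≠ d` and
  `Q_d(x) ≠ 0`, `Q_d` the odd part of `(x + √d)^{12}` (root counting: `≤ 13 < ℓ` bad values);
* `C_add_X_pow_twelve_sub`, `C_add_X_pow_twelve` — `(a + X)^{12} ∓ (a − X)^{12}` in `ℤ[X]` with
  `X²` grouped (for the substitution `X ↦ √D`, `X² ↦ D`);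
* `nonabelianImage_of_cmCartanImage` (registered sub-goal; main namespace) — the CM torsion fact
  implies that for `ℓ > max L₀ 13` two elements of `Γ_ℚ` do not commute on `W[ℓ]` (Serre 1972
  §4.5 in the CM case, here DERIVED): `σ₀` with `χ(σ₀) = −1` conjugates `U = a + √D` to
  `Ū = a − √D`; if `σ₀` commuted with the element `τ` acting as `U^{12}` then `U^{12} = Ū^{12}`,
  i.e. `2Q_D(a)√D = 0`, contradicting `ℓ ∤ 2Q_D(a)` and the injectivity of `√D`.

Everything is proved (axioms `propext`, `Classical.choice`, `Quot.sound`); no `def`, no named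
fact. Deliberately NOT here: irreducibility and the scalar commutant (helpers 2/2), the
composition with the rational-part reduction, Minkowski and the torsion leaf (the stub file).
-/

noncomputable section

-- `Summit.<Summit>.<Problem>` is the mandated summit-side namespace (CONVENTIONS §2); for the
-- single-conjunct summit `ABC` the two coincide, so the duplicate `ABC.ABC` is deliberate.
set_option linter.dupNamespace false

namespace Summit.ABC.ABC.Theorems.IsotypicMinkowski

open Polynomial

namespace CMIsotypicCore

/-- **Counting step.** For a prime `ℓ > 13` and any `d ∈ 𝔽_ℓ` there is `x ∈ 𝔽_ℓ` with `x² ≠ d`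
and `Q_d(x) ≠ 0`, where `2·√d·Q_d(x) = (x + √d)^{12} − (x − √d)^{12}`
(`Q_d(x) = 12x^{11} + 220x⁹d + 792x⁷d² + 792x⁵d³ + 220x³d⁴ + 12xd⁵`): the two polynomials are non-zero
of degrees `11` and `2` (the leading coefficient `12` is a unit as `ℓ > 12`), so they have at most
`13 < ℓ` roots in all. [folklore] -/
theorem exists_sq_ne_and_eval_ne_zero {ℓ : ℕ} [Fact ℓ.Prime] (h13 : 13 < ℓ) (d : ZMod ℓ) :
    ∃ x : ZMod ℓ, x ^ 2 - d ≠ 0 ∧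
      12 * x ^ 11 + 220 * x ^ 9 * d + 792 * x ^ 7 * d ^ 2 + 792 * x ^ 5 * d ^ 3 +
        220 * x ^ 3 * d ^ 4 + 12 * x * d ^ 5 ≠ 0 := by
  classical
  have hℓ : ℓ.Prime := Fact.out
  set Q : (ZMod ℓ)[X] := C 12 * X ^ 11 + C (220 * d) * X ^ 9 + C (792 * d ^ 2) * X ^ 7 +
    C (792 * d ^ 3) * X ^ 5 + C (220 * d ^ 4) * X ^ 3 + C (12 * d ^ 5) * X ^ 1 with hQ
  have hQeval : ∀ x : ZMod ℓ, Q.eval x = 12 * x ^ 11 + 220 * x ^ 9 * d + 792 * x ^ 7 * d ^ 2 +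
      792 * x ^ 5 * d ^ 3 + 220 * x ^ 3 * d ^ 4 + 12 * x * d ^ 5 := fun x ↦ by
    simp only [hQ, eval_add, eval_mul, eval_C, eval_pow, eval_X]
    ring
  have h12 : (12 : ZMod ℓ) ≠ 0 := by
    intro h
    have h' : ((12 : ℕ) : ZMod ℓ) = 0 := by exact_mod_cast h
    rw [ZMod.natCast_eq_zero_iff] at h'
    exact absurd (Nat.le_of_dvd (by norm_num) h') (by omega)
  have hQne : Q ≠ 0 := by
    intro h
    have hc : Q.coeff 11 = 12 := by
      simp only [hQ, coeff_add, coeff_C_mul_X_pow]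
      norm_num
    rw [h, coeff_zero] at hc
    exact h12 hc.symm
  have hQdeg : Q.natDegree ≤ 11 := by
    rw [hQ]
    refine natDegree_add_le_of_degree_le (natDegree_add_le_of_degree_le
      (natDegree_add_le_of_degree_le (natDegree_add_le_of_degree_le
      (natDegree_add_le_of_degree_le ?_ ?_) ?_) ?_) ?_) ?_ <;>
      exact (natDegree_C_mul_X_pow_le _ _).trans (by norm_num)
  set R : (ZMod ℓ)[X] := X ^ 2 - C d with hR
  have hRne : R ≠ 0 := X_pow_sub_C_ne_zero (by norm_num) d
  have hRdeg : R.natDegree = 2 := natDegree_X_pow_sub_C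
  set S : Finset (ZMod ℓ) := Q.roots.toFinset ∪ R.roots.toFinset with hS
  have hScard : S.card ≤ 13 := by
    calc S.card ≤ Q.roots.toFinset.card + R.roots.toFinset.card := Finset.card_union_le _ _
      _ ≤ Multiset.card Q.roots + Multiset.card R.roots :=
          Nat.add_le_add (Multiset.toFinset_card_le _) (Multiset.toFinset_card_le _)
      _ ≤ 11 + 2 := Nat.add_le_add ((card_roots' Q).trans hQdeg) ((card_roots' R).trans hRdeg.le)
  obtain ⟨x, hx⟩ : ∃ x : ZMod ℓ, x ∉ S := by
    by_contra hcon
    push Not at hcon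
    have hSu : S = Finset.univ := Finset.eq_univ_iff_forall.2 hcon
    have : Fintype.card (ZMod ℓ) ≤ 13 := by
      rw [← Finset.card_univ, ← hSu]; exact hScard
    rw [ZMod.card] at this
    omega
  rw [hS, Finset.mem_union, not_or, Multiset.mem_toFinset, Multiset.mem_toFinset,
    mem_roots hQne, mem_roots hRne] at hx
  refine ⟨x, fun h ↦ hx.2 ?_, fun h ↦ hx.1 ?_⟩
  · simp only [IsRoot.def, hR, eval_sub, eval_pow, eval_X, eval_C]
    exact h
  · rw [IsRoot.def, hQeval]
    exact h

/-- **The binomial identity behind "Cartan image ⟹ non-abelian image"**, in `ℤ[X]`: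
`(a + X)^{12} − (a − X)^{12} = X · 2(12a^{11} + 220a⁹X² + 792a⁷X⁴ + 792a⁵X⁶ + 220a³X⁸ + 12aX^{10})`
(only odd powers of `X` survive), written with `X²` grouped so that `X² ↦ D` can be substituted
after evaluation at `√D`. [folklore] -/
theorem C_add_X_pow_twelve_sub (a : ℤ) :
    ((C a + X) ^ 12 - (C a - X) ^ 12 : ℤ[X]) =
      X * (2 * (12 * C a ^ 11 + 220 * C a ^ 9 * X ^ 2 + 792 * C a ^ 7 * (X ^ 2) ^ 2 +
        792 * C a ^ 5 * (X ^ 2) ^ 3 + 220 * C a ^ 3 * (X ^ 2) ^ 4 + 12 * C a * (X ^ 2) ^ 5)) := by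
  ring

/-- **The binomial expansion behind "Cartan image ⟹ irreducibility"**, in `ℤ[X]`: `(a + X)^{12}`
split into its even part `a^{12} + 66a^{10}X² + 495a⁸X⁴ + 924a⁶X⁶ + 495a⁴X⁸ + 66a²X^{10} + X^{12}` and
`X` times its odd part `12a^{11} + 220a⁹X² + … + 12aX^{10}`, with `X²` grouped for the substitution
`X² ↦ D`. [folklore] -/
theorem C_add_X_pow_twelve (a : ℤ) :
    ((C a + X) ^ 12 : ℤ[X]) =
      (C a ^ 12 + 66 * C a ^ 10 * X ^ 2 + 495 * C a ^ 8 * (X ^ 2) ^ 2 + 924 * C a ^ 6 * (X ^ 2) ^ 3 +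
        495 * C a ^ 4 * (X ^ 2) ^ 4 + 66 * C a ^ 2 * (X ^ 2) ^ 5 + (X ^ 2) ^ 6) +
      X * (12 * C a ^ 11 + 220 * C a ^ 9 * X ^ 2 + 792 * C a ^ 7 * (X ^ 2) ^ 2 +
        792 * C a ^ 5 * (X ^ 2) ^ 3 + 220 * C a ^ 3 * (X ^ 2) ^ 4 + 12 * C a * (X ^ 2) ^ 5) := by
  ring

end CMIsotypicCore

open CMIsotypicCore in
/-- **The CM torsion fact makes the mod-`ℓ` image non-abelian** (registered sub-goal of
`stub_CMIsotypicCoreOf`; the CM case of Serre 1972 §4.5, derived here from the hypothesis `hF2`).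
At a prime `ℓ > max L₀ 13`: pick `a` with `a + √D` a unit and `ℓ ∤ Q_D(a)`
(`exists_sq_ne_and_eval_ne_zero`); let `τ ∈ ker χ` act on `W[ℓ]` as `U^{12}`, `U = a + √D`, and
`σ₀` with `χ(σ₀) = −1`. Since `√D` anti-commutes with `σ₀`, `σ₀ U = Ū σ₀` with `Ū = a − √D`, hence
`σ₀ U^{12} = Ū^{12} σ₀`; if `σ₀` and `τ` commuted on `W[ℓ]` then `Ū^{12} = U^{12}`, i.e. (the
identity `C_add_X_pow_twelve_sub` evaluated at `√D`, `√D² = D`) `2Q_D(a)·√D = 0` on `W[ℓ]`; `√D` is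
injective (`ℓ ∤ D`) and `W[ℓ] ≠ 0` (`#W[ℓ] = ℓ²`), so `ℓ ∣ 2Q_D(a)` — absurd. [folklore] -/
theorem nonabelianImage_of_cmCartanImage
    (hF2 : ∃ L₀ : ℕ, ∀ (W : WeierstrassCurve ℚ) [W.IsElliptic], W.HasCM → ∀ ℓ : ℕ, ℓ.Prime → L₀ < ℓ →
      ∃ (φ : AddMonoid.End (W.geomTorsion ℓ)) (D : ℤ) (χ : Field.absoluteGaloisGroup ℚ →* ℤˣ),
        (∀ P : W.geomTorsion ℓ, φ (φ P) = D • P) ∧ ¬ (ℓ : ℤ) ∣ D ∧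
        (∀ c : ℤ, ∃ P : W.geomTorsion ℓ, φ P ≠ c • P) ∧
        (∃ σ : Field.absoluteGaloisGroup ℚ, χ σ ≠ 1) ∧
        (∀ (σ : Field.absoluteGaloisGroup ℚ) (P : W.geomTorsion ℓ),
          φ (σ • P) = ((χ σ : ℤˣ) : ℤ) • σ • φ P) ∧
        (∀ a b : ℤ, ¬ (ℓ : ℤ) ∣ a ^ 2 - D * b ^ 2 →
          ∃ σ : Field.absoluteGaloisGroup ℚ, χ σ = 1 ∧ ∀ P : W.geomTorsion ℓ,
            σ • P = (((a : AddMonoid.End (W.geomTorsion ℓ)) +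
              (b : AddMonoid.End (W.geomTorsion ℓ)) * φ) ^ 12) P)) :
    ∃ L₀ : ℕ, ∀ (W : WeierstrassCurve ℚ) [W.IsElliptic], W.HasCM → ∀ ℓ : ℕ, ℓ.Prime → L₀ < ℓ →
      ∃ (σ τ : Field.absoluteGaloisGroup ℚ) (P : W.geomTorsion ℓ), σ • τ • P ≠ τ • σ • P := by
  classical
  obtain ⟨L₀, h2⟩ := hF2
  refine ⟨max L₀ 13, ?_⟩
  intro W _ hCM ℓ hℓ hL
  have hL₀ : L₀ < ℓ := lt_of_le_of_lt (le_max_left _ _) hL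
  have h13 : 13 < ℓ := lt_of_le_of_lt (le_max_right _ _) hL
  haveI : Fact ℓ.Prime := ⟨hℓ⟩
  obtain ⟨φ, D, χ, hφφ, hD, -, ⟨σ₀, hσ₀⟩, hsemi, hbig⟩ := h2 W hCM ℓ hℓ hL₀
  letI : Module (ZMod ℓ) (W.geomTorsion ℓ) := AddSubgroup.torsionBy.zmodModule
  have hmul : ∀ (f g : AddMonoid.End (W.geomTorsion ℓ)) (P : W.geomTorsion ℓ),
      (f * g) P = f (g P) := fun _ _ _ ↦ rfl
  have hadd : ∀ (f g : AddMonoid.End (W.geomTorsion ℓ)) (P : W.geomTorsion ℓ),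
      (f + g) P = f P + g P := fun _ _ _ ↦ rfl
  have hsub : ∀ (f g : AddMonoid.End (W.geomTorsion ℓ)) (P : W.geomTorsion ℓ),
      (f - g) P = f P - g P := fun _ _ _ ↦ rfl
  -- `χ σ₀ = -1`, so `φ` anticommutes with `σ₀`
  have hχ₀ : ((χ σ₀ : ℤˣ) : ℤ) = -1 := by
    rcases Int.units_eq_one_or (χ σ₀) with h | h
    · exact absurd h hσ₀
    · rw [h]; rfl
  have hanti : ∀ P : W.geomTorsion ℓ, φ (σ₀ • P) = -(σ₀ • φ P) := fun P ↦ by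
    rw [hsemi σ₀ P, hχ₀, neg_one_zsmul]
  -- `φ² = D` as endomorphisms; `φ` is injective since `ℓ ∤ D`
  have hφ2 : φ ^ 2 = (D : AddMonoid.End (W.geomTorsion ℓ)) := by
    refine DFunLike.ext _ _ fun P ↦ ?_
    rw [sq, hmul, hφφ, AddMonoid.End.intCast_apply]
  have hDmod : ((D : ℤ) : ZMod ℓ) ≠ 0 := fun h ↦
    hD ((ZMod.intCast_zmod_eq_zero_iff_dvd D ℓ).1 h)
  have hφinj : ∀ P : W.geomTorsion ℓ, φ P = 0 → P = 0 := fun P hP ↦ by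
    have h1 : D • P = 0 := by rw [← hφφ, hP, map_zero]
    have h2 : ((D : ℤ) : ZMod ℓ) • P = 0 := by rwa [Int.cast_smul_eq_zsmul]
    exact (smul_eq_zero.1 h2).resolve_left hDmod
  -- choose `a` with `a + √D` a unit and `ℓ ∤ Q(a)`
  obtain ⟨x, hx1, hx2⟩ := exists_sq_ne_and_eval_ne_zero h13 ((D : ℤ) : ZMod ℓ)
  set a : ℤ := ((x.val : ℕ) : ℤ) with ha_def
  have ha : ((a : ℤ) : ZMod ℓ) = x := by
    rw [ha_def, Int.cast_natCast, ZMod.natCast_zmod_val]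
  set Q : ℤ := 12 * a ^ 11 + 220 * a ^ 9 * D + 792 * a ^ 7 * D ^ 2 + 792 * a ^ 5 * D ^ 3 +
    220 * a ^ 3 * D ^ 4 + 12 * a * D ^ 5 with hQ_def
  have haunit : ¬ (ℓ : ℤ) ∣ a ^ 2 - D * 1 ^ 2 := fun h ↦ by
    apply hx1
    have h' := (ZMod.intCast_zmod_eq_zero_iff_dvd _ ℓ).2 h
    push_cast [ha] at h'
    linear_combination h'
  have hQ : ¬ (ℓ : ℤ) ∣ Q := fun h ↦ by
    apply hx2
    have h' := (ZMod.intCast_zmod_eq_zero_iff_dvd _ ℓ).2 h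
    rw [hQ_def] at h'
    push_cast [ha] at h'
    linear_combination h'
  -- the Galois element acting as `U ^ 12`, `U = a + √D`; `σ₀` conjugates `U` to `Ubar = a - √D`
  obtain ⟨τ, -, hτ⟩ := hbig a 1 haunit
  set U : AddMonoid.End (W.geomTorsion ℓ) :=
    (a : AddMonoid.End (W.geomTorsion ℓ)) + ((1 : ℤ) : AddMonoid.End (W.geomTorsion ℓ)) * φ
    with hU_def
  set Ubar : AddMonoid.End (W.geomTorsion ℓ) :=
    (a : AddMonoid.End (W.geomTorsion ℓ)) - φ with hUbar_def
  have hU : U = (a : AddMonoid.End (W.geomTorsion ℓ)) + φ := by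
    rw [hU_def, Int.cast_one, one_mul]
  let g : AddMonoid.End (W.geomTorsion ℓ) := DistribSMul.toAddMonoidHom (W.geomTorsion ℓ) σ₀
  have hg : ∀ P, g P = σ₀ • P := fun P ↦ rfl
  have hconj : SemiconjBy g U Ubar := by
    refine DFunLike.ext _ _ fun P ↦ ?_
    rw [hmul, hmul, hU, hUbar_def, hadd, hsub, AddMonoid.End.intCast_apply,
      AddMonoid.End.intCast_apply, map_add, map_zsmul, hg, hg, hanti, sub_neg_eq_add]
  refine ⟨σ₀, τ, ?_⟩
  by_contra hcon
  push Not at hcon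
  -- from commutation: `Ubar ^ 12 = U ^ 12`
  have hpow : Ubar ^ 12 = U ^ 12 := by
    have hc12 : g * U ^ 12 = Ubar ^ 12 * g := (hconj.pow_right 12).eq
    refine DFunLike.ext _ _ fun P ↦ ?_
    have h1 : (g * U ^ 12) (σ₀⁻¹ • P) = (Ubar ^ 12 * g) (σ₀⁻¹ • P) := by rw [hc12]
    rw [hmul, hmul, hg, hg, smul_inv_smul, ← hτ, hcon, smul_inv_smul] at h1
    -- h1 : τ • P = (Ubar ^ 12) P
    rw [← h1, hτ]
  -- the polynomial identity transported along `aeval φ`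
  have hident : U ^ 12 - Ubar ^ 12 = φ * ((2 * Q : ℤ) : AddMonoid.End (W.geomTorsion ℓ)) := by
    have h := congrArg (Polynomial.aeval (R := ℤ) φ) (C_add_X_pow_twelve_sub a)
    simp only [map_sub, map_pow, map_add, map_mul, Polynomial.aeval_C, Polynomial.aeval_X,
      algebraMap_int_eq, Int.coe_castRingHom, map_ofNat] at h
    rw [hφ2] at h
    rw [hU, hUbar_def, h, hQ_def]
    congr 1
    push_cast
    rfl
  -- hence `2Q • φ = 0`, i.e. `ℓ ∣ 2Q`: contradiction
  have hzero : φ * ((2 * Q : ℤ) : AddMonoid.End (W.geomTorsion ℓ)) = 0 := by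
    rw [← hident, hpow, sub_self]
  -- a non-zero `ℓ`-torsion point
  have hcard : Nat.card (W.geomTorsion ℓ) = ℓ ^ 2 := by
    have h := Literature.NumberTheory.EllipticCurves.natCard_geomTorsion_int_eq_sq W
      (n := (ℓ : ℤ)) (by exact_mod_cast hℓ.ne_zero)
    rwa [Int.natAbs_natCast] at h
  haveI : Finite (W.geomTorsion ℓ) :=
    Nat.finite_of_card_ne_zero (by rw [hcard]; exact pow_ne_zero 2 hℓ.ne_zero)
  haveI : Nontrivial (W.geomTorsion ℓ) := by
    rw [← Finite.one_lt_card_iff_nontrivial, hcard]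
    exact Nat.one_lt_pow two_ne_zero hℓ.one_lt
  obtain ⟨P, hP⟩ := exists_ne (0 : W.geomTorsion ℓ)
  have h1 : φ ((2 * Q) • P) = 0 := by
    have := congrArg (fun f : AddMonoid.End (W.geomTorsion ℓ) ↦ f P) hzero
    simpa only [hmul, AddMonoid.End.intCast_apply, AddMonoid.End.zero_apply] using this
  have h2 : (2 * Q) • P = 0 := hφinj _ h1
  have h3 : (((2 * Q : ℤ)) : ZMod ℓ) • P = 0 := by rwa [Int.cast_smul_eq_zsmul]
  have h4 : (((2 * Q : ℤ)) : ZMod ℓ) = 0 := (smul_eq_zero.1 h3).resolve_right hP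
  rw [ZMod.intCast_zmod_eq_zero_iff_dvd] at h4
  have hprime : Prime (ℓ : ℤ) := Nat.prime_iff_prime_int.1 hℓ
  rcases hprime.dvd_or_dvd h4 with h5 | h5
  · have : (ℓ : ℤ) ≤ 2 := Int.le_of_dvd two_pos h5
    omega
  · exact hQ h5

end Summit.ABC.ABC.Theorems.IsotypicMinkowski

end
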